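import Literature.NumberTheory.LFunctions.ExplicitFormulaPsi
import Mathlib.Analysis.SpecialFunctions.Pow.Real
import HarnessLib

/-!
# RH-FREE — Explicit error terms in the truncated Riemann–von Mangoldt formula: Cully-Hugill–Johnston 2023 (`M x log x/T`) and 2025 (`M x (log x)^{1−ω}/T`) («nothing here bears on the truth of RH»)

(2026-08-27: the table facts are RESTATED over `x ≥ x_M` — `…_table4'`, `…_table1'`, `…_thm13'` — and the first typings refuted; see "Domain correction" below.)

Topic `Literature/NumberTheory/LFunctions` (RH literature-typing tranche 1, L4 "explicit zero
statistics", gen 2: the explicit BRIDGE from zero statistics to prime bounds). Label: **RH-FREE**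
(one clearly marked RH-CONDITIONAL item, `CullyHugillJohnston2023_thm51`, has the shape
`RiemannHypothesis → …`). Published theorems vendored as NAMED FACTS (`def … : Prop`, D-0014;
nothing asserted, users take `(h : …)`; the printed tables are Lean lists of numerals, a row is
instantiated with `h … (by norm_num [CHJ2023.table4])`), plus cheap PROVED consequences. Nothing
here bears on the truth of RH.

The tree holds the truncated explicit formula only INEXPLICITLY: Montgomery–Vaughan Thm. 12.5,
`Literature.NumberTheory.LFunctions.truncatedExplicitFormula_psi` (PROVED,
`ExplicitFormulaPsiProofs.lean`: `∃ C`, for `ψ₀`). The present file types the EXPLICIT versions in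
the same vocabulary: `ψ = Chebyshev.psi` (the sources' `ψ(x) = Σ_{n ≤ x} Λ(n)`, right-continuous
— NOT `ψ₀`; the sources state their theorems for `ψ`), and the truncated zero sum
`Literature.NumberTheory.LFunctions.zetaZeroSumTrunc x T = Σ_{|γ| ≤ T} m(ρ) x^ρ/ρ` (non-trivial
zeros with multiplicity, `|Im ρ| ≤ T` closed, as in the sources' `Σ_{|γ| ≤ T}`).

## Sources and what is typed

* **Cully-Hugill–Johnston 2023**, Int. J. Number Theory 19 (2023) 1205–1228 (arXiv:2111.10001v5;
  Zbl 1531.11086) `[corpus:paper:arxiv-2111.10001 p0002 (Thm. 1.2), p0015 (Thm. 5.1), p0020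
  (Table 4)]`:
  - `CullyHugillJohnston2023_thm12` — **Theorem 1.2** as printed (existential form): "For any
    `α ∈ (0, 1/2]` there exist constants `M` and `x_M` such that for
    `max{51, log x} < T < (x^α − 2)/2`, `ψ(x) = x − Σ_{|γ| ≤ T} x^ρ/ρ + O*(M x log x/T)` for all
    `x ≥ x_M`."
  - `CullyHugillJohnston2023_table4'` — the admissible triples `(log x_M, α, M)` of **Table 4**
    (appendix of arXiv v5 = the text dated 9 Jan 2024): `(40, 1/2, 6.431)`, `(10³, 1/2, 5.823)`,
    `(10¹⁰, 1/2, 4.143)`, `(10¹³, 1/2, 4.140)`, `(10³, 1/10, 2.045)`, `(10¹⁰, 1/10, 1.384)`,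
    `(10³, 1/100, 0.6651)`, `(10¹⁰, 1/100, 0.6269)` (the optimising `λ` column is not recorded).
    DISCREPANCY RECORDED, NOT RESOLVED: the sentence after Theorem 1.2 (arXiv v5, and as quoted
    in Cully-Hugill–Johnston 2025, Thm. 1.1) reads "Some admissible values of `x_M, α, M` are
    `(40, 1/2, 5.03)` and `(10³, 1/100, 0.5597)`, with more given in Table 4", whereas Table 4 of
    the same text prints `6.431` and `0.6651` for these `(x_M, α)` and §§6–7 of that text use the
    Table-4 values (`M = 0.6651`, `M = 2.045`). We type the TABLE values, which are the larger —
    hence weaker and safe — constants; the journal pages could not be opened from this seat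
    (zbMATH review truncated).
  - `CullyHugillJohnston2023_thm51` — **Theorem 5.1** (RH-CONDITIONAL as printed): "Assuming the
    Riemann hypothesis, we can take `M = 4.150` in (1.5) with `log x ≥ 1000` and `α = 1/2`."
* **Cully-Hugill–Johnston 2025** ("… II"), Funct. Approx. Comment. Math. 73 (2025) 223–242
  (arXiv:2402.04272v3) `[corpus:paper:arxiv-2402.04272 p0002–p0003 (Thms. 1.2–1.3, Table 1)]`:
  - `CullyHugillJohnston2025_thm12` — **Theorem 1.2** (existential form): "For any `α ∈ (0,1/2]`
    and `ω ∈ [0,1]` there exist constants `M` and `x_M` such that for some `T* ∈ [T, 2T]` with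
    `max{51, log²x} < T < (x^α − 2)/4`, we have `ψ(x) = x − Σ_{|γ| ≤ T*} x^ρ/ρ + O*(M x (log x)^{1−ω}/T)`
    for all `x ≥ x_M`."
  - `CullyHugillJohnston2025_table1'` — the same with the admissible `(log x_M, α, ω, M)` of
    **Table 1** (ten rows; `λ` not recorded).
  - `CullyHugillJohnston2025_thm13'` — **Theorem 1.3** (short intervals; "`h = h(x)` any
    nonnegative function"; "In Table 1, some admissible values of `x_M` and `M` are given"): for
    some `T* ∈ [T, 2T]`,
    `ψ(x+h) − ψ(x) = h − Σ_{|γ| ≤ T*} ((x+h)^ρ − x^ρ)/ρ + O*(M (x+h)(log(x+h))^{1−ω}/T + M x (log x)^{1−ω}/T)`,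
    typed with the rows of Table 1.

## Conventions

* `O*(h)` ("`f = g + O*(h)` means `|f − g| ≤ h`"; Dudek 2016 uses `<`) is typed with `≤` — the
  weaker, safe reading.
* `x^α` and `(log x)^{1−ω}` are `Real.rpow`; thresholds "`log x_M = 10³`" are typed as
  `10^3 ≤ Real.log x`, etc.
* The identity is typed, as for MV Thm. 12.5 in `ExplicitFormulaPsi.lean`, as a bound on the
  complex norm `‖(ψ x : ℂ) − (x − zetaZeroSumTrunc x T)‖` (the zero sum is real by conjugation
  symmetry, but its terms are complex).
* "For some `T* ∈ [T, 2T]`" depends on `x` and `T`: typed as `∃ T', T ≤ T' ∧ T' ≤ 2T ∧ …` inside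
  the `∀ x, ∀ T`; in Theorem 1.3 ONE `T*` serves the difference `ψ(x+h) − ψ(x)` (source, remark
  before §4: "we require `T* ∈ [T,2T]` to be the same value in both the integrals").

## Status notes (no endorsement)

Dudek 2016 (Funct. Approx. 55, Thm. 1.3; arXiv:1401.4233 §2.1): "Let `x > e^{60}` be half an odd
integer and suppose that `T ∈ (50, x)` is not the ordinate of any zero. Then
`ψ(x) = x − Σ_{|γ| < T} x^ρ/ρ + O*(2x log²x/T)`" is NOT typed as a fact: Fiori–Kadiri–Swidinsky
(J. Math. Anal. Appl. 527 (2023) 127426, Rem. 3.3) record that "[Dud16] is wrong as stated, and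
used" (`ζ'/ζ` unbounded at the negative even integers where a lemma is applied; Lemma 2.7 used
for Lemma 2.8, costing a factor `20`), "while these can be corrected they may not obtain their
claimed results"; they use instead the bound `ε₁(x,T) = 2 log²x/T` under Cully-Hugill–Johnston's
hypotheses (their Prop. 3.4: `x > e^{50}`, `3 log x < T < √x/3`). That proposition, in the
closed-`T` form of this file, is PROVED below from the Table-4 row `(40, 1/2, 6.431)`
(`CullyHugillJohnston2023_table4.dudek_shape`). Cully-Hugill–Johnston 2023 itself is refereed
(IJNT) and reworks Wolke 1983 and Ramaré 2016 avoiding the errors of their averaging arguments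
(source §1); part II corrects further slips of Ramaré 2016, Thms. 1.2/3.1 (source II, §1).

## Proved here (no new hypotheses)

`CullyHugillJohnston2023_table4'.row_40` (the headline row), `.dudek_shape` (FKS 2023 Prop. 3.4 in
closed-`T` form: `x > e^{50}`, `3 log x < T < √x/3` ⟹ `|ψ(x) − x| ≤ |Σ_{|γ|≤T} x^ρ/ρ| + 2x log²x/T`),
`.abs_sub_le` (triangle-inequality form `|ψ(x) − x| ≤ |Σ| + M x log x/T`);
`CullyHugillJohnston2025_table1'.row_40`.

## Domain correction (2026-08-27, rh-lit-explicit-1 g6): the table facts are stated over `x ≥ x_M`; the first typings are REMOVED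

The three table-indexed facts were first typed (as `CullyHugillJohnston2023_table4`,
`CullyHugillJohnston2025_table1`, `CullyHugillJohnston2025_thm13`) with the binder
`∀ x : ℝ, X ≤ Real.log x → …`. Over ALL reals this is not the printed "for all `x ≥ x_M`"
(`log x_M = X`): Mathlib's `Real.log` is even (`Real.log (−x) = Real.log x`) and `Real.rpow` of a
negative base is `|x|^α cos(απ)`, so for the rows with `α = 1/10, 1/100, 1/85` the premises are
satisfiable at `x = −e^{1000}` while the conclusion (`… ≤ M x (log x)^{1−ω}/T < 0`) fails: those
defs were REFUTABLE as Lean propositions (kernel refutations `not_CullyHugillJohnston2023_table4`,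
`not_CullyHugillJohnston2025_table1`, `not_CullyHugillJohnston2025_thm13` landed with the correction,
2026-08-27) and every theorem taking one of them was vacuous. The present statements
`CullyHugillJohnston2023_table4'`, `CullyHugillJohnston2025_table1'`, `CullyHugillJohnston2025_thm13'`
type the printed range `x ≥ x_M` as `Real.exp X ≤ x`; all consumers
(`FioriKadiriSwidinsky2023_prop34_zeroSumPsi'`, `FioriKadiriSwidinsky2023_eq41'{,_of_numerical_rh,_explicit}`,
`JY2023.abs_psi_sub_le_of_chj2025`, `JohnstonYang2023_eq37_chj2025`) were migrated to them, after which
the refuted defs, their refutations and the old ⇒ new bridges were retired (a refutable `Prop` must not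
stay citable as a named fact). The existential facts `CullyHugillJohnston2023_thm12`,
`CullyHugillJohnston2025_thm12` (`∃ x_M`) and `CullyHugillJohnston2023_thm51` (`α = 1/2`: a negative base
has `x^{1/2} = 0`, so its premises already force nothing at `x < 0`) were never affected.

## References

* M. Cully-Hugill, D. R. Johnston, Int. J. Number Theory 19 (2023) 1205–1228, Thms. 1.2, 5.1,
  Table 4 (arXiv:2111.10001v5). [CullyHugillJohnston2023]
* M. Cully-Hugill, D. R. Johnston, Funct. Approx. Comment. Math. 73 (2025) 223–242, Thms. 1.2–1.3,
  Table 1 (arXiv:2402.04272v3). [CullyHugillJohnston2025]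
* A. W. Dudek, Funct. Approx. Comment. Math. 55 (2016) 177–197, Thm. 1.3. [Dudek2016]
* A. Fiori, H. Kadiri, J. Swidinsky, J. Math. Anal. Appl. 527 (2023) 127426, §3.1 (Thms. 3.1–3.2,
  Rem. 3.3, Prop. 3.4). [FioriKadiriSwidinsky2023]
* H. L. Montgomery, R. C. Vaughan, *Multiplicative Number Theory I*, Thm. 12.5 (the inexplicit
  form, `truncatedExplicitFormula_psi`). [MontgomeryVaughan2007]
-/

noncomputable section

open Complex
open scoped Real Chebyshev

namespace Literature.NumberTheory.LFunctions

/-! ## The printed tables -/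

namespace CHJ2023

/-- **Cully-Hugill–Johnston 2023, Table 4** (appendix; arXiv v5): the admissible triples
`(log x_M, α, M)` for Theorem 1.2 (column `λ` = `0.48, 0.52, 0.52, 0.52, 1.05, 1.06, 1.80, 1.88`
not recorded). [cite: CullyHugillJohnston2023, Table 4] -/
def table4 : List (ℝ × ℝ × ℝ) :=
  [(40, 1 / 2, 6.431), (10 ^ 3, 1 / 2, 5.823), (10 ^ 10, 1 / 2, 4.143), (10 ^ 13, 1 / 2, 4.140),
   (10 ^ 3, 1 / 10, 2.045), (10 ^ 10, 1 / 10, 1.384), (10 ^ 3, 1 / 100, 0.6651),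
   (10 ^ 10, 1 / 100, 0.6269)]

end CHJ2023

namespace CHJ2025

/-- **Cully-Hugill–Johnston 2025, Table 1**: the admissible quadruples `(log x_M, α, ω, M)` for
Theorems 1.2–1.3 (column `λ` not recorded; "The last two entries are specifically used to prove
Theorem 1.4", primes between consecutive `90`-th powers). [cite: CullyHugillJohnston2025, Table 1] -/
def table1 : List (ℝ × ℝ × ℝ × ℝ) :=
  [(40, 1 / 2, 0, 2.894), (10 ^ 3, 1 / 2, 0, 1.681), (10 ^ 10, 1 / 2, 0.3, 2.275),
   (10 ^ 13, 1 / 2, 1, 19.81), (10 ^ 3, 1 / 10, 0.2, 1.260), (10 ^ 10, 1 / 10, 0.9, 4.415),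
   (10 ^ 3, 1 / 100, 0.8, 3.615), (10 ^ 10, 1 / 100, 1, 9.631), (10 ^ 3, 1 / 85, 0.9, 6.391),
   (4 * 10 ^ 3, 1 / 85, 0.9, 5.462)]

end CHJ2025

/-! ## Cully-Hugill–Johnston 2023 -/

/-- NAMED FACT (**Cully-Hugill–Johnston 2023, Theorem 1.2**, as printed, existential form): for
every `α ∈ (0, 1/2]` there are `M`, `x_M` such that for all `x ≥ x_M` and all `T` with
`max{51, log x} < T < (x^α − 2)/2`,
`|ψ(x) − (x − Σ_{|γ| ≤ T} x^ρ/ρ)| ≤ M x log x/T`. Unconditional. Users take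
`(h : CullyHugillJohnston2023_thm12)`. [cite: CullyHugillJohnston2023, Thm. 1.2] -/
def CullyHugillJohnston2023_thm12 : Prop :=
  ∀ α : ℝ, 0 < α → α ≤ 1 / 2 → ∃ M xM : ℝ, ∀ x : ℝ, xM ≤ x →
    ∀ T : ℝ, 51 < T → Real.log x < T → T < (x ^ α - 2) / 2 →
      ‖(ψ x : ℂ) - (x - zetaZeroSumTrunc x T)‖ ≤ M * x * Real.log x / T

/-- NAMED FACT (**Cully-Hugill–Johnston 2023, Theorem 1.2 with Table 4**, CORRECTED DOMAIN — the
printed "for all `x ≥ x_M`" typed as `Real.exp X ≤ x`, `X = log x_M`): for each row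
`(X, α, M) ∈ CHJ2023.table4` — e.g. `(40, 1/2, 6.431)`, `(10³, 1/100, 0.6651)` — all `x ≥ e^X` and all
`T` with `max{51, log x} < T < (x^α − 2)/2`, `|ψ(x) − (x − Σ_{|γ| ≤ T} x^ρ/ρ)| ≤ M x log x/T`. (Table
values, the weaker ones; see the module docstring.) Unconditional. Users take
`(h : CullyHugillJohnston2023_table4')`. [cite: CullyHugillJohnston2023, Thm. 1.2 and Table 4] -/
def CullyHugillJohnston2023_table4' : Prop :=
  ∀ X α M : ℝ, (X, α, M) ∈ CHJ2023.table4 →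
    ∀ x : ℝ, Real.exp X ≤ x →
      ∀ T : ℝ, 51 < T → Real.log x < T → T < (x ^ α - 2) / 2 →
        ‖(ψ x : ℂ) - (x - zetaZeroSumTrunc x T)‖ ≤ M * x * Real.log x / T

/-- NAMED FACT, **RH-CONDITIONAL** as printed (**Cully-Hugill–Johnston 2023, Theorem 5.1**:
"Assuming the Riemann hypothesis, we can take `M = 4.150` in (1.5) with `log x ≥ 1000` and
`α = 1/2`."): `RiemannHypothesis →` for all `x` with `log x ≥ 1000` and
`max{51, log x} < T < (x^{1/2} − 2)/2`, `|ψ(x) − (x − Σ_{|γ| ≤ T} x^ρ/ρ)| ≤ 4.150 x log x/T`.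
Users take `(h : CullyHugillJohnston2023_thm51)` and feed it RH; nothing here bears on the truth of
RH. [cite: CullyHugillJohnston2023, Thm. 5.1] -/
def CullyHugillJohnston2023_thm51 : Prop :=
  RiemannHypothesis →
    ∀ x : ℝ, 1000 ≤ Real.log x →
      ∀ T : ℝ, 51 < T → Real.log x < T → T < (x ^ (1 / 2 : ℝ) - 2) / 2 →
        ‖(ψ x : ℂ) - (x - zetaZeroSumTrunc x T)‖ ≤ 4.150 * x * Real.log x / T

/-! ## Cully-Hugill–Johnston 2025 (part II) -/

/-- NAMED FACT (**Cully-Hugill–Johnston 2025, Theorem 1.2**, as printed, existential form): for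
every `α ∈ (0, 1/2]` and `ω ∈ [0, 1]` there are `M`, `x_M` such that for all `x ≥ x_M` and all
`T` with `max{51, log²x} < T < (x^α − 2)/4` there is `T* ∈ [T, 2T]` with
`|ψ(x) − (x − Σ_{|γ| ≤ T*} x^ρ/ρ)| ≤ M x (log x)^{1−ω}/T`. Unconditional. Users take
`(h : CullyHugillJohnston2025_thm12)`. [cite: CullyHugillJohnston2025, Thm. 1.2] -/
def CullyHugillJohnston2025_thm12 : Prop :=
  ∀ α : ℝ, 0 < α → α ≤ 1 / 2 → ∀ ω : ℝ, 0 ≤ ω → ω ≤ 1 → ∃ M xM : ℝ, ∀ x : ℝ, xM ≤ x →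
    ∀ T : ℝ, 51 < T → Real.log x ^ 2 < T → T < (x ^ α - 2) / 4 →
      ∃ T' : ℝ, T ≤ T' ∧ T' ≤ 2 * T ∧
        ‖(ψ x : ℂ) - (x - zetaZeroSumTrunc x T')‖ ≤ M * x * Real.log x ^ (1 - ω) / T

/-- NAMED FACT (**Cully-Hugill–Johnston 2025, Theorem 1.2 with Table 1**, CORRECTED DOMAIN — the
printed "for all `x ≥ x_M`" typed as `Real.exp X ≤ x`): for each row `(X, α, ω, M) ∈ CHJ2025.table1`,
all `x ≥ e^X` and all `T` with `max{51, log²x} < T < (x^α − 2)/4`, there is `T* ∈ [T, 2T]` with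
`|ψ(x) − (x − Σ_{|γ| ≤ T*} x^ρ/ρ)| ≤ M x (log x)^{1−ω}/T`. Unconditional. Users take
`(h : CullyHugillJohnston2025_table1')`. [cite: CullyHugillJohnston2025, Thm. 1.2 and Table 1] -/
def CullyHugillJohnston2025_table1' : Prop :=
  ∀ X α ω M : ℝ, (X, α, ω, M) ∈ CHJ2025.table1 →
    ∀ x : ℝ, Real.exp X ≤ x →
      ∀ T : ℝ, 51 < T → Real.log x ^ 2 < T → T < (x ^ α - 2) / 4 →
        ∃ T' : ℝ, T ≤ T' ∧ T' ≤ 2 * T ∧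
          ‖(ψ x : ℂ) - (x - zetaZeroSumTrunc x T')‖ ≤ M * x * Real.log x ^ (1 - ω) / T

/-- NAMED FACT (**Cully-Hugill–Johnston 2025, Theorem 1.3 with Table 1**, CORRECTED DOMAIN — the
printed "for all `x ≥ x_M`" typed as `Real.exp X ≤ x`): for the rows `(X, α, ω, M) ∈ CHJ2025.table1`,
every `x ≥ e^X`, every real `h ≥ 0` and all `T` with `max{51, log²x} < T < (x^α − 2)/4`, there is ONE
`T* ∈ [T, 2T]` with
`|ψ(x+h) − ψ(x) − (h − Σ_{|γ|≤T*} ((x+h)^ρ − x^ρ)/ρ)| ≤ M (x+h)(log(x+h))^{1−ω}/T + M x (log x)^{1−ω}/T`.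
Unconditional. Users take `(h : CullyHugillJohnston2025_thm13')`.
[cite: CullyHugillJohnston2025, Thm. 1.3 and Table 1] -/
def CullyHugillJohnston2025_thm13' : Prop :=
  ∀ X α ω M : ℝ, (X, α, ω, M) ∈ CHJ2025.table1 →
    ∀ x : ℝ, Real.exp X ≤ x → ∀ h : ℝ, 0 ≤ h →
      ∀ T : ℝ, 51 < T → Real.log x ^ 2 < T → T < (x ^ α - 2) / 4 →
        ∃ T' : ℝ, T ≤ T' ∧ T' ≤ 2 * T ∧
          ‖(ψ (x + h) : ℂ) - ψ x -
              (h - (zetaZeroSumTrunc (x + h) T' - zetaZeroSumTrunc x T'))‖ ≤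
            M * (x + h) * Real.log (x + h) ^ (1 - ω) / T + M * x * Real.log x ^ (1 - ω) / T

/-! ## Consequences of the table facts (proved) -/

namespace CullyHugillJohnston2023_table4'

/-- The headline row (corrected domain): for `x ≥ e^{40}` and `max{51, log x} < T < (√x − 2)/2`,
`|ψ(x) − (x − Σ_{|γ|≤T} x^ρ/ρ)| ≤ 6.431 x log x/T`.
[cite: CullyHugillJohnston2023, Thm. 1.2 and Table 4 (row log x_M = 40)] -/
theorem row_40 (h : CullyHugillJohnston2023_table4') {x T : ℝ} (hx : Real.exp 40 ≤ x)
    (hT : 51 < T) (hT' : Real.log x < T) (hT'' : T < (x ^ (1 / 2 : ℝ) - 2) / 2) :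
    ‖(ψ x : ℂ) - (x - zetaZeroSumTrunc x T)‖ ≤ 6.431 * x * Real.log x / T :=
  h 40 (1 / 2) 6.431 (by simp [CHJ2023.table4]) x hx T hT hT' hT''

/-- Triangle-inequality form of any row (corrected domain): for `x ≥ e^X`,
`|ψ(x) − x| ≤ |Σ_{|γ|≤T} x^ρ/ρ| + M x log x/T`. [cite: CullyHugillJohnston2023, Thm. 1.2 and Table 4] -/
theorem abs_sub_le (h : CullyHugillJohnston2023_table4') {X α M : ℝ} (hrow : (X, α, M) ∈ CHJ2023.table4)
    {x T : ℝ} (hx : Real.exp X ≤ x) (hT : 51 < T) (hT' : Real.log x < T)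
    (hT'' : T < (x ^ α - 2) / 2) :
    |ψ x - x| ≤ ‖zetaZeroSumTrunc x T‖ + M * x * Real.log x / T := by
  have h1 := h X α M hrow x hx T hT hT' hT''
  have e : ((ψ x : ℂ) - x) = ((ψ x : ℂ) - (x - zetaZeroSumTrunc x T)) + (-zetaZeroSumTrunc x T) := by
    ring
  have h2 : ‖(ψ x : ℂ) - x‖ ≤ ‖(ψ x : ℂ) - (x - zetaZeroSumTrunc x T)‖ + ‖-zetaZeroSumTrunc x T‖ := by
    rw [e]; exact norm_add_le _ _
  rw [norm_neg] at h2
  have h3 : ‖(ψ x : ℂ) - x‖ = |ψ x - x| := by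
    rw [← Complex.ofReal_sub, Complex.norm_real, Real.norm_eq_abs]
  linarith

/-- **Dudek's shape under Cully-Hugill–Johnston's hypotheses** (corrected domain; Fiori–Kadiri–
Swidinsky 2023, Prop. 3.4): for `x > e^{50}` and `3 log x < T < √x/3`,
`|ψ(x) − x| ≤ |Σ_{|γ| ≤ T} x^ρ/ρ| + 2x log²x/T`.
[cite: CullyHugillJohnston2023, Thm. 1.2 and Table 4] [cite: FioriKadiriSwidinsky2023, Prop. 3.4] -/
theorem dudek_shape (h : CullyHugillJohnston2023_table4') {x T : ℝ} (hx : Real.exp 50 < x)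
    (hT : 3 * Real.log x < T) (hT' : T < Real.sqrt x / 3) :
    |ψ x - x| ≤ ‖zetaZeroSumTrunc x T‖ + 2 * x * Real.log x ^ 2 / T := by
  have hx0 : 0 < x := lt_trans (Real.exp_pos 50) hx
  have hlog : 50 < Real.log x := by
    rw [Real.lt_log_iff_exp_lt hx0]; exact hx
  have hx40 : Real.exp 40 ≤ x := le_trans (Real.exp_le_exp.2 (by norm_num)) hx.le
  have hT51 : (51 : ℝ) < T := by linarith
  have hTl : Real.log x < T := by linarith
  have hsqrt6 : (6 : ℝ) ≤ Real.sqrt x := by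
    rw [show (6 : ℝ) = Real.sqrt 36 by rw [show (36 : ℝ) = 6 ^ 2 by norm_num, Real.sqrt_sq (by norm_num)]]
    apply Real.sqrt_le_sqrt
    have : Real.exp 50 ≥ 36 := by
      have := Real.add_one_le_exp (50 : ℝ); linarith
    linarith
  have hrpow : x ^ (1 / 2 : ℝ) = Real.sqrt x := by rw [Real.sqrt_eq_rpow]
  have hT'' : T < (x ^ (1 / 2 : ℝ) - 2) / 2 := by rw [hrpow]; linarith
  have h1 := h.abs_sub_le (X := 40) (α := 1 / 2) (M := 6.431) (by simp [CHJ2023.table4]) hx40 hT51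
    hTl hT''
  have hT0 : 0 < T := by linarith
  have hM : 6.431 * x * Real.log x / T ≤ 2 * x * Real.log x ^ 2 / T := by
    apply div_le_div_of_nonneg_right _ hT0.le
    have : 6.431 * Real.log x ≤ 2 * Real.log x ^ 2 := by nlinarith
    nlinarith
  linarith

end CullyHugillJohnston2023_table4'

namespace CullyHugillJohnston2025_table1'

/-- The headline row of part II (corrected domain): for `x ≥ e^{40}` and
`max{51, log²x} < T < (√x − 2)/4` there is `T* ∈ [T, 2T]` with
`|ψ(x) − (x − Σ_{|γ|≤T*} x^ρ/ρ)| ≤ 2.894 x log x/T` (`ω = 0`).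
[cite: CullyHugillJohnston2025, Thm. 1.2 and Table 1 (row log x_M = 40)] -/
theorem row_40 (h : CullyHugillJohnston2025_table1') {x T : ℝ} (hx : Real.exp 40 ≤ x)
    (hT : 51 < T) (hT' : Real.log x ^ 2 < T) (hT'' : T < (x ^ (1 / 2 : ℝ) - 2) / 4) :
    ∃ T' : ℝ, T ≤ T' ∧ T' ≤ 2 * T ∧
      ‖(ψ x : ℂ) - (x - zetaZeroSumTrunc x T')‖ ≤ 2.894 * x * Real.log x / T := by
  obtain ⟨T', h1, h2, h3⟩ := h 40 (1 / 2) 0 2.894 (by simp [CHJ2025.table1]) x hx T hT hT' hT''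
  refine ⟨T', h1, h2, ?_⟩
  rw [sub_zero, Real.rpow_one] at h3
  exact h3

end CullyHugillJohnston2025_table1'

end Literature.NumberTheory.LFunctions

end
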